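import Summits.NavierStokesRegularity.NavierStokesRegularity.Theorems.TypeICertificateLadderLadderGlue

/-!
# NavierStokesRegularity — route `TypeICertificateLadder`, support item `RungOneSplice`

Settles `stmt-NavierStokesRegularity-14843` (`Theses.TypeICertificateLadder.RungOneSplice`
`:= RungReynoldsOne → DescentToRungOne → NoTypeIBlowup`), with the three route Props expanded
VERBATIM and no route (`Theses`) file imported, so that the gate's `RungOneSplice_holds` link can
import this module into the route file without an import cycle (LANDING NOTE in
`Theses/TypeICertificateLadder.lean`; pattern of `Theorems/TypeICertificateLadderLadderGlue.lean`).
The statement below is therefore definitionally the route decl `RungOneSplice`.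

RUNG-ONE SPLICE. Rung one `X_1` (`RungReynoldsOne`: an eventual dimensionless rate
`√(T − t)‖u(t,x)‖ ≤ √ν` forces a smooth extension past `T`) together with the descent statement
(`DescentToRungOne`: for `C ≥ 1`, a Type-I(`C`) classical Leray–Hopf rapidly-decaying-datum
solution that does NOT extend past `T` eventually has rate `≤ √ν`) gives the crux `NoTypeIBlowup`.
Proof: by the ladder glue (`typeICertificateLadder_ladderGlue_proof`, item
stmt-NavierStokesRegularity-2887) it suffices to prove every rung `X_C`, `C > 0`; given a
Type-I(`C`) solution that did not extend, raise the level to `max C 1 ≥ 1` (rungs are nested),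
descend to rate `≤ √ν` by `DescentToRungOne`, and extend by `RungReynoldsOne` — contradiction.
Both premises are used. Pure bookkeeping; no analysis (Leray 1934 §19 / KNSS 2009 §1 only for the
Type-I rate vocabulary).
-/

namespace Summit.NavierStokesRegularity.NavierStokesRegularity.Theorems

open Filter Topology

/-- **Rung-one splice** (item stmt-NavierStokesRegularity-14843, route `TypeICertificateLadder`,
stated verbatim; definitionally `Theses.TypeICertificateLadder.RungOneSplice`, i.e.
`RungReynoldsOne → DescentToRungOne → NoTypeIBlowup` with each Prop expanded): if (rung one) every
classical solution of unforced Navier–Stokes on `ℝ³ × [0, T)` which is Leray–Hopf from its rapidly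
decaying datum and has eventual dimensionless rate `√(T − t)‖u(t,x)‖ ≤ √ν` extends smoothly past
`T`, and (descent) for every `C ≥ 1` such a solution with eventual rate `≤ C√ν` that does not
extend past `T` eventually has rate `≤ √ν`, then there is no Type-I blow-up for Clay data.
Proof: via `typeICertificateLadder_ladderGlue_proof` it suffices to prove every rung `X_C`,
`C > 0`; by contradiction, raise the level to `max C 1`, descend to rung one, extend.
[bookkeeping; Leray 1934 §19, KNSS 2009 §1 for the Type-I rate] -/
theorem typeICertificateLadder_rungOneSplice_proof :
    (∀ (ν T : ℝ), 0 < ν → 0 < T → ∀ (u : ℝ → EuclideanSpace ℝ (Fin 3) → EuclideanSpace ℝ (Fin 3)) (p : ℝ → EuclideanSpace ℝ (Fin 3) → ℝ), Literature.Analysis.FluidPDE.IsClassicalNSSolutionOn (Set.Ico 0 T) ν 0 u p → Literature.Analysis.FluidPDE.IsLerayHopfOn T ν 0 (u 0) u → Literature.Analysis.FluidPDE.HasRapidSpatialDecay (u 0) → (∀ᶠ t in 𝓝[<] T, ∀ x, Real.sqrt (T - t) * ‖u t x‖ ≤ Real.sqrt ν) → Literature.Analysis.FluidPDE.HasSmoothExtensionPast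 ν 0 u T) →
    (∀ C : ℝ, 1 ≤ C → ∀ (ν T : ℝ), 0 < ν → 0 < T → ∀ (u : ℝ → EuclideanSpace ℝ (Fin 3) → EuclideanSpace ℝ (Fin 3)) (p : ℝ → EuclideanSpace ℝ (Fin 3) → ℝ), Literature.Analysis.FluidPDE.IsClassicalNSSolutionOn (Set.Ico 0 T) ν 0 u p → Literature.Analysis.FluidPDE.IsLerayHopfOn T ν 0 (u 0) u → Literature.Analysis.FluidPDE.HasRapidSpatialDecay (u 0) → (∀ᶠ t in 𝓝[<] T, ∀ x, Real.sqrt (T - t) * ‖u t x‖ ≤ C * Real.sqrt ν) → ¬ Literature.Analysis.FluidPDE.HasSmoothExtensionPast ν 0 u T → ∀ᶠ t in 𝓝[<] T, ∀ x, Real.sqrt (T - t) * ‖u t x‖ ≤ Real.sqrt ν) →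
    ∀ (ν T : ℝ), 0 < ν → 0 < T → ∀ (u : ℝ → EuclideanSpace ℝ (Fin 3) → EuclideanSpace ℝ (Fin 3)) (p : ℝ → EuclideanSpace ℝ (Fin 3) → ℝ), Literature.Analysis.FluidPDE.IsClassicalNSSolutionOn (Set.Ico 0 T) ν 0 u p → Literature.Analysis.FluidPDE.IsLerayHopfOn T ν 0 (u 0) u → Literature.Analysis.FluidPDE.HasRapidSpatialDecay (u 0) → Literature.Analysis.FluidPDE.IsTypeIBlowup u T → Literature.Analysis.FluidPDE.HasSmoothExtensionPast ν 0 u T := by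
  intro hR1 hD
  -- by the ladder glue it suffices to prove every rung `X_C`, `C > 0`
  refine typeICertificateLadder_ladderGlue_proof fun C _ => ?_
  intro ν T hν hT u p hcl hLH hdec hrate
  by_contra hext
  -- raise the level to `max C 1 ≥ 1` (rungs are nested)
  have hrate' : ∀ᶠ t in 𝓝[<] T, ∀ x, Real.sqrt (T - t) * ‖u t x‖ ≤ max C 1 * Real.sqrt ν := by
    filter_upwards [hrate] with t ht
    intro x
    exact (ht x).trans (mul_le_mul_of_nonneg_right (le_max_left _ _) (Real.sqrt_nonneg ν))
  -- descend to rung one, then extend by rung one: contradiction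
  exact hext (hR1 ν T hν hT u p hcl hLH hdec
    (hD (max C 1) (le_max_right _ _) ν T hν hT u p hcl hLH hdec hrate' hext))

/-- **The splice is lossless** (route `TypeICertificateLadder`, companion to
`typeICertificateLadder_rungOneSplice_proof`): conversely the crux `NoTypeIBlowup` (expanded
verbatim) gives both rung one (`RungReynoldsOne`, the rung `X_1` — by
`typeICertificateLadder_rung_mono`-free direct use of the crux at Type-I constant `√ν`) and the
descent statement (`DescentToRungOne`, vacuously: under the crux a Type-I(`C`) solution always
extends). Hence `NoTypeIBlowup ↔ RungReynoldsOne ∧ DescentToRungOne`: rung one is the base of the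
ladder and `DescentToRungOne` is exactly its remaining height. [bookkeeping] -/
theorem typeICertificateLadder_noTypeIBlowup_iff_rungOne_and_descent :
    (∀ (ν T : ℝ), 0 < ν → 0 < T → ∀ (u : ℝ → EuclideanSpace ℝ (Fin 3) → EuclideanSpace ℝ (Fin 3)) (p : ℝ → EuclideanSpace ℝ (Fin 3) → ℝ), Literature.Analysis.FluidPDE.IsClassicalNSSolutionOn (Set.Ico 0 T) ν 0 u p → Literature.Analysis.FluidPDE.IsLerayHopfOn T ν 0 (u 0) u → Literature.Analysis.FluidPDE.HasRapidSpatialDecay (u 0) → Literature.Analysis.FluidPDE.IsTypeIBlowup u T → Literature.Analysis.FluidPDE.HasSmoothExtensionPast ν 0 u T) ↔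
    ((∀ (ν T : ℝ), 0 < ν → 0 < T → ∀ (u : ℝ → EuclideanSpace ℝ (Fin 3) → EuclideanSpace ℝ (Fin 3)) (p : ℝ → EuclideanSpace ℝ (Fin 3) → ℝ), Literature.Analysis.FluidPDE.IsClassicalNSSolutionOn (Set.Ico 0 T) ν 0 u p → Literature.Analysis.FluidPDE.IsLerayHopfOn T ν 0 (u 0) u → Literature.Analysis.FluidPDE.HasRapidSpatialDecay (u 0) → (∀ᶠ t in 𝓝[<] T, ∀ x, Real.sqrt (T - t) * ‖u t x‖ ≤ Real.sqrt ν) → Literature.Analysis.FluidPDE.HasSmoothExtensionPast ν 0 u T) ∧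
    (∀ C : ℝ, 1 ≤ C → ∀ (ν T : ℝ), 0 < ν → 0 < T → ∀ (u : ℝ → EuclideanSpace ℝ (Fin 3) → EuclideanSpace ℝ (Fin 3)) (p : ℝ → EuclideanSpace ℝ (Fin 3) → ℝ), Literature.Analysis.FluidPDE.IsClassicalNSSolutionOn (Set.Ico 0 T) ν 0 u p → Literature.Analysis.FluidPDE.IsLerayHopfOn T ν 0 (u 0) u → Literature.Analysis.FluidPDE.HasRapidSpatialDecay (u 0) → (∀ᶠ t in 𝓝[<] T, ∀ x, Real.sqrt (T - t) * ‖u t x‖ ≤ C * Real.sqrt ν) → ¬ Literature.Analysis.FluidPDE.HasSmoothExtensionPast ν 0 u T → ∀ᶠ t in 𝓝[<] T, ∀ x, Real.sqrt (T - t) * ‖u t x‖ ≤ Real.sqrt ν)) := by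
  constructor
  · intro hI
    refine ⟨?_, ?_⟩
    · -- rung one: the rate `≤ √ν` is the Type-I rate with constant `√ν`
      intro ν T hν hT u p hcl hLH hdec hrate
      refine hI ν T hν hT u p hcl hLH hdec ⟨Real.sqrt ν, ?_⟩
      have hlt : ∀ᶠ t in 𝓝[<] T, t < T := self_mem_nhdsWithin
      filter_upwards [hrate, hlt] with t ht htT
      intro x
      have hTt : 0 < Real.sqrt (T - t) := Real.sqrt_pos.2 (sub_pos.2 htT)
      rw [le_div_iff₀ hTt, mul_comm]
      exact ht x
    · -- descent: vacuous, the solution extends by the crux at Type-I constant `C√ν`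
      intro C _ ν T hν hT u p hcl hLH hdec hrate hext
      refine absurd (hI ν T hν hT u p hcl hLH hdec ⟨C * Real.sqrt ν, ?_⟩) hext
      have hlt : ∀ᶠ t in 𝓝[<] T, t < T := self_mem_nhdsWithin
      filter_upwards [hrate, hlt] with t ht htT
      intro x
      have hTt : 0 < Real.sqrt (T - t) := Real.sqrt_pos.2 (sub_pos.2 htT)
      rw [le_div_iff₀ hTt, mul_comm]
      exact ht x
  · rintro ⟨hR1, hD⟩
    exact typeICertificateLadder_rungOneSplice_proof hR1 hD

end Summit.NavierStokesRegularity.NavierStokesRegularity.Theorems
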